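import Summits.CriticalPhenomena.PercolationContinuityZ3.Theorems.PercNearOneGluingNoHeavyLowerTailMajorityGluingQCertSymParts
import HarnessLib

/-!
# Part 4 of 18 of the orbit certificate of the cell `(12,7)` at `c = 157/100`: data and digest (lane prim-rate, constants-miner 1, gen 36; generated by cert/mksym.py)

Support file for the closed crux `NoHeavyLowerTail` (stmt-CriticalPhenomena-4575), majority-gluing line.  The symmetrised certificate of the cell `(12,7)`
(kit j286395, symcert.py) is checked IN PARTS (`…MajorityGluingQCertSymParts`): this file holds part 4 (0 multiplier terms, 2 marginal slacks,
0 rows, 0 squares; 4098 contributions) and its DIGEST `twelveSevenSymP4D` (45 orbit keys), verified by `decide +kernel` (`twelveSevenSymP4_digest`).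
The parts are glued in `…MajorityGluingQCertSymTwelveSeven`.  No sorries. [cite: VandenbergKahn2001, Thm 1.2 (p. 123)]
-/

namespace Summit.CriticalPhenomena.PercolationContinuityZ3.Theorems

namespace HubOnly
namespace QCert

/-- Row representatives of part 4: `(A, X, B, Y, n, masks of f(A,X), f(B,Y), f(A∪B,X∩Y), f(∅,X∪Y))`. -/
def twelveSevenSymP4Rows : List RowE :=
  []

/-- Square representatives of part 4: `(a, b, n, mask₁, mask₂)`. -/
def twelveSevenSymP4Sqs : List SqE :=
  []

/-- **Part 4** of the `(12,7)` orbit certificate at `157/100`. -/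
def twelveSevenSymP4 : SymCert :=
  ⟨⟨12, 7, 157, 100, 1, [], [], []⟩,
    [],
    [(0, 2, 50000000), (0, 2047, 30334353956421763072)],
    [twelveSevenSymP4Rows], [twelveSevenSymP4Sqs]⟩

/-- The digest of part 4: `(orbit key, coefficient total)` in increasing key order (computed by cert/mksym.py, verified below). -/
def twelveSevenSymP4D : List (ℕ × ℤ) :=
  [((4099 : ℕ), (50000000 : ℤ)), (4100, 50000000), (4103, 500000000), (4104, 500000000), (4111, 2250000000), (4112, 2250000000), (4127, 6000000000), 
    (4128, 6000000000), (4159, 10500000000), (4160, 10500000000), (4223, 12600000000), (4224, 12600000000), (4351, 10500000000), (4352, 10500000000), 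
    (4607, 6000000000), (4608, 6000000000), (5119, 2250000000), (5120, 2250000000), (6143, 500000000), (6144, 30334353956921763072), 
    (8191, 50000000), (8192, 50000000), (14338, 303343539564217630720), (16384, 30334353956421763072), (30726, 1365045928038979338240), 
    (32770, 303343539564217630720), (63502, 3640122474770611568640), (65542, 1365045928038979338240), (129054, 6370214330848570245120), 
    (131086, 3640122474770611568640), (260158, 7644257197018284294144), (262174, 6370214330848570245120), (522366, 6370214330848570245120), 
    (524350, 7644257197018284294144), (1046782, 3640122474770611568640), (1048702, 6370214330848570245120), (2095614, 1365045928038979338240), 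
    (2097406, 3640122474770611568640), (4193278, 303343539564217630720), (4194814, 1365045928038979338240), (8388606, 30334353956421763072), 
    (8389630, 303343539564217630720), (8390654, 30334353956421763072), (16781313, -50000000), (16783359, -30334353956421763072)]

/-- **The digest of part 4 is `twelveSevenSymP4D`** (kernel evaluation of the part's 4098 contributions). -/
theorem twelveSevenSymP4_digest : twelveSevenSymP4.digest 20 = twelveSevenSymP4D := by
  decide +kernel

end QCert
end HubOnly

end Summit.CriticalPhenomena.PercolationContinuityZ3.Theorems
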